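import Summits.Ventures.PercRepro.RankLevelSetDepCountGiantB2

/-!
# PercRepro — S2: THE PAIR COUNTS WITH THE CIRCUIT REMOVED (p7, gen 3; sub-claim S2)

The pairs `(C, B′)` of the level count (RankLevelSetDepCountGiantA: `C` a circuit with `3 ≤ |C| = k ≤ q + 1`, `B′` a
`(q + 1 − k)`-subset of `E` DISJOINT from `C`) were counted by `#circuits · C(n, q + 1 − k)` (`card_pairsF_le`) and, for
the giant pairs, by `#circuits · C(F_max, q + 1 − k)` (`card_pairsGiant_le`). Since `B′` avoids its circuit, the second
factor is `C(n − k, q + 1 − k)` resp. `C(F_max − k, q + 1 − k)`: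

* **`card_filter_disjoint_product_le`** — the generic count: pairs `(C, B′)` with `C` in a family of `k`-subsets of `S`
  and `B′` a `j`-subset of `S` disjoint from `C` number at most `#family · C(|S| − k, j)`;
* **`card_pairsF_le'`** — `#pairsF ≤ Σ_k s_k·C(n − k, q + 1 − k)`;
* **`card_pairsGiant_le'`** — `#pairsGiant ≤ Σ_k s_k·C(min(f, q + d) − k, q + 1 − k)`.
Axioms: standard.
-/

open scoped Matroid

namespace PercRepro

namespace Matroid

open Set Finset

variable {α : Type} {M : _root_.Matroid α}

open scoped Classical in
/-- **Pairs with a disjoint second coordinate**: for a family `A` of `k`-element subsets of `↑S`, the pairs `(C, B′)`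
with `C ∈ A` and `B′` a `j`-element subset of `↑S` disjoint from `C` number at most `#A · C(|S| − k, j)`. -/
theorem card_filter_disjoint_product_le (A : Finset (Set α)) (S : Finset α) (j k : ℕ)
    (hA : ∀ C ∈ A, C ⊆ (S : Set α) ∧ C.ncard = k) :
    ((A ×ˢ subsF S j).filter (fun p : Set α × Set α => Disjoint p.2 p.1)).card ≤ A.card * (S.card - k).choose j := by
  rw [Finset.product_eq_biUnion, Finset.filter_biUnion]
  refine Finset.card_biUnion_le.trans ?_
  have hterm : ∀ C ∈ A, (((subsF S j).image (fun b => (C, b))).filter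
      (fun p : Set α × Set α => Disjoint p.2 p.1)).card ≤ (S.card - k).choose j := by
    intro C hC
    obtain ⟨hCS, hCk⟩ := hA C hC
    have hCfin : C.Finite := S.finite_toSet.subset hCS
    set Cf := hCfin.toFinset with hCf
    have hCfS : Cf ⊆ S := by
      intro x hx
      rw [hCf, Set.Finite.mem_toFinset] at hx
      exact_mod_cast hCS hx
    have hCfcard : Cf.card = k := by
      rw [hCf, ← Set.ncard_eq_toFinset_card C hCfin]; exact hCk
    rw [Finset.filter_image]
    refine Finset.card_image_le.trans ?_
    have hsub : (subsF S j).filter (fun b : Set α => Disjoint b C) ⊆ subsF (S \ Cf) j := by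
      intro b hb
      rw [Finset.mem_filter] at hb
      obtain ⟨hb1, hb2⟩ := hb
      unfold subsF at hb1
      rw [Finset.mem_image] at hb1
      obtain ⟨s, hs, rfl⟩ := hb1
      rw [Finset.mem_powersetCard] at hs
      apply mem_subsF_of
      · intro x hx
        rw [Finset.coe_sdiff, Set.mem_sdiff]
        refine ⟨hs.1 hx, ?_⟩
        intro hxC
        rw [hCf, Finset.mem_coe, Set.Finite.mem_toFinset] at hxC
        exact Set.disjoint_left.1 hb2 hx hxC
      · rw [Set.ncard_coe_finset]; exact hs.2
    calc ((subsF S j).filter (fun b : Set α => Disjoint b C)).card ≤ (subsF (S \ Cf) j).card :=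
          Finset.card_le_card hsub
      _ ≤ (S \ Cf).card.choose j := card_subsF_le _ _
      _ = (S.card - k).choose j := by rw [Finset.card_sdiff_of_subset hCfS, hCfcard]
  calc (∑ C ∈ A, (((subsF S j).image (fun b => (C, b))).filter
        (fun p : Set α × Set α => Disjoint p.2 p.1)).card)
      ≤ ∑ C ∈ A, (S.card - k).choose j := Finset.sum_le_sum hterm
    _ = A.card * (S.card - k).choose j := by rw [Finset.sum_const, smul_eq_mul]

open scoped Classical in
/-- **The number of pairs, with the circuit removed from the second factor**:
`#pairsF ≤ Σ_k s_k·C(n − k, q + 1 − k)`. -/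
theorem card_pairsF_le' [M.Finite] (q : ℕ) :
    (pairsF M q).card ≤
      ∑ k ∈ Finset.Icc 3 (q + 1), {C | M.IsCircuit C ∧ C.ncard = k}.ncard * (M.E.ncard - k).choose (q + 1 - k) := by
  unfold pairsF
  rw [Finset.filter_biUnion]
  refine Finset.card_biUnion_le.trans ?_
  apply Finset.sum_le_sum
  intro k _
  calc ((circF M k ×ˢ subsF (groundF M) (q + 1 - k)).filter
        (fun p : Set α × Set α => Disjoint p.2 p.1 ∧ M.eRk (p.1 ∪ p.2) ≤ q)).card
      ≤ ((circF M k ×ˢ subsF (groundF M) (q + 1 - k)).filter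
        (fun p : Set α × Set α => Disjoint p.2 p.1)).card :=
        Finset.card_le_card (by
          intro p hp
          rw [Finset.mem_filter] at hp ⊢
          exact ⟨hp.1, hp.2.1⟩)
    _ ≤ (circF M k).card * ((groundF M).card - k).choose (q + 1 - k) := by
        apply card_filter_disjoint_product_le
        intro C hC
        have h := mem_circF.1 hC
        refine ⟨?_, h.2⟩
        rw [coe_groundF]
        exact h.1.subset_ground
    _ = _ := by rw [card_circF, card_groundF]

open scoped Classical in
/-- **The giant pairs, with the circuit removed from the second factor**: they all lie inside the one giant flat of
`≤ min(f, q + d)` points, so `#pairsGiant ≤ Σ_k s_k·C(min(f, q + d) − k, q + 1 − k)`. -/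
theorem card_pairsGiant_le' [M.Finite] {q f f' ν₁ νi : ℕ} (hq : 1 ≤ q)
    (hflat : ∀ X ⊆ M.E, M.eRk X ≤ q → X.ncard ≤ f)
    (hflat' : ∀ X ⊆ M.E, M.eRk X ≤ (q - 1 : ℕ) → X.ncard ≤ f')
    (hinter : ∀ X ⊆ M.E, M.eRk X ≤ (q - 1 : ℕ) → (X.ncard : ℕ∞) ≤ M.eRk X + νi)
    {d : ℕ} (hd : M.E.encard = M.eRank + d) (h2 : d + νi < 2 * ν₁) :
    (pairsGiant M q f' ν₁).card ≤
      ∑ k ∈ Finset.Icc 3 (q + 1),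
        {C | M.IsCircuit C ∧ C.ncard = k}.ncard * (min f (q + d) - k).choose (q + 1 - k) := by
  rcases (pairsGiant M q f' ν₁).eq_empty_or_nonempty with hemp | ⟨p₀, hp₀⟩
  · rw [hemp, Finset.card_empty]; exact Nat.zero_le _
  set F := M.closure (p₀.1 ∪ p₀.2) with hF
  have hFE : F ⊆ M.E := M.closure_subset_ground _
  have hFfin : F.Finite := M.ground_finite.subset hFE
  set Ff := hFfin.toFinset with hFf
  have hFcard : Ff.card ≤ min f (q + d) := by
    rw [hFf, ← Set.ncard_eq_toFinset_card _ hFfin]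
    apply le_min
    · exact hflat F hFE (by
        have := pairsF_data (Finset.mem_filter.1 (Finset.mem_filter.1 hp₀).1).1
        rw [hF, M.eRk_closure_eq]; exact this.2.2.2.1)
    · obtain ⟨r, hr⟩ := exists_eRk_eq_nat (M := M) hFE
      have hcap := encard_le_eRk_add_of_encard_eq (M := M) hFE hd
      rw [hr, ← hFfin.cast_ncard_eq] at hcap
      have hcap' : F.ncard ≤ r + d := by exact_mod_cast hcap
      have hrq : r ≤ q := by
        have := pairsF_data (Finset.mem_filter.1 (Finset.mem_filter.1 hp₀).1).1
        have h := this.2.2.2.1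
        rw [← M.eRk_closure_eq, ← hF, hr] at h
        exact_mod_cast h
      omega
  -- every giant pair `(C, B′)` has `C ⊆ F` (the pair's closure) and `B′ ⊆ F` disjoint from `C`
  have hsub : pairsGiant M q f' ν₁ ⊆
      (Finset.Icc 3 (q + 1)).biUnion (fun k => ((circF M k).filter (fun C => C ⊆ F) ×ˢ subsF Ff (q + 1 - k)).filter
        (fun p : Set α × Set α => Disjoint p.2 p.1)) := by
    intro p hp
    have hcl : M.closure (p.1 ∪ p.2) = F := closure_eq_of_giant hq hflat' hinter hd h2 hp hp₀
    have hpF := Finset.mem_filter.1 (Finset.mem_filter.1 hp).1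
    have hdisj : Disjoint p.2 p.1 := by
      have := hpF.1
      unfold pairsF at this
      exact (Finset.mem_filter.1 this).2.1
    obtain ⟨hp1E, hp2E, hU, hrk, k, hk, h1, hp2c⟩ := pairsF_data hpF.1
    have hUE : p.1 ∪ p.2 ⊆ M.E := union_subset hp1E hp2E
    have hUF : p.1 ∪ p.2 ⊆ F := by rw [← hcl]; exact M.subset_closure _ hUE
    rw [Finset.mem_biUnion]
    refine ⟨k, hk, ?_⟩
    rw [Finset.mem_filter, Finset.mem_product, Finset.mem_filter]
    refine ⟨⟨⟨h1, subset_union_left.trans hUF⟩, mem_subsF_of ?_ hp2c⟩, hdisj⟩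
    rw [hFf, Set.Finite.coe_toFinset]
    exact subset_union_right.trans hUF
  calc (pairsGiant M q f' ν₁).card
      ≤ ((Finset.Icc 3 (q + 1)).biUnion (fun k => ((circF M k).filter (fun C => C ⊆ F) ×ˢ subsF Ff (q + 1 - k)).filter
          (fun p : Set α × Set α => Disjoint p.2 p.1))).card := Finset.card_le_card hsub
    _ ≤ ∑ k ∈ Finset.Icc 3 (q + 1), (((circF M k).filter (fun C => C ⊆ F) ×ˢ subsF Ff (q + 1 - k)).filter
          (fun p : Set α × Set α => Disjoint p.2 p.1)).card := Finset.card_biUnion_le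
    _ ≤ _ := by
        apply Finset.sum_le_sum
        intro k _
        calc (((circF M k).filter (fun C => C ⊆ F) ×ˢ subsF Ff (q + 1 - k)).filter
              (fun p : Set α × Set α => Disjoint p.2 p.1)).card
            ≤ ((circF M k).filter (fun C => C ⊆ F)).card * (Ff.card - k).choose (q + 1 - k) := by
              apply card_filter_disjoint_product_le
              intro C hC
              rw [Finset.mem_filter] at hC
              have h := mem_circF.1 hC.1
              refine ⟨?_, h.2⟩
              rw [hFf, Set.Finite.coe_toFinset]
              exact hC.2
          _ ≤ (circF M k).card * (min f (q + d) - k).choose (q + 1 - k) :=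
              Nat.mul_le_mul (Finset.card_filter_le _ _) (Nat.choose_le_choose _ (by omega))
          _ = _ := by rw [card_circF]

end Matroid

end PercRepro
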